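import Summits.AtomisticToContinuum.FouriersLaw.Theses.HoelderEscapeProfile
import Summits.AtomisticToContinuum.FouriersLaw.Theorems.HoelderEscapeProfileCornerNoDipSeam
import Summits.AtomisticToContinuum.FouriersLaw.Theorems.HoelderEscapeProfileCornerNoDipProfileRepresentation
import Summits.AtomisticToContinuum.FouriersLaw.Theorems.HoelderEscapeProfileCornerNoDipBochnerEnvelope
import Summits.AtomisticToContinuum.FouriersLaw.Theorems.HoelderEscapeProfileFibreCalculus

/-!
# K1-conditional split glue of crux `CornerNoDip` (stmt-AtomisticToContinuum-16009, route `HoelderEscapeProfile`) — line `heatprofile`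

The route's K1 `LocalEnergyHalfHoelder` (stmt-AtomisticToContinuum-16008, consumed by `closes` anyway) supplies the
return-value bound `S̄_ν(0) ≤ C√ν`; with the Bochner envelope `|S̄_ν(x)| ≤ S̄_ν(0)` (landed stub
`stub_bochnerEnvelope`, p163224) the short range of the seam extends to `|x| ≤ δ/√ν` at cost `(3/2)Cδ³`, so modulo
K1 the residual of K2 is near-positivity of the Abel heating profile on the DIFFUSIVE COMPACTS `δ < |x|√ν ≤ L` and
beyond:

* `corner_noDip_of_profile_of_envelope` — the abstract seam (pure real analysis over `tsum`), variant of
  `corner_noDip_of_profile` (HoelderEscapeProfileCornerNoDipSeam.lean) with the sup bound and the sub-diffusive window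
  traded for the envelope + the return-value bound;
* `cornerNoDip_of_localEnergyHalfHoelder_of_diffusive_of_far` — THREE-hypothesis glue
  `LocalEnergyHalfHoelder → DiffusiveNegativePartNegligible → FarNegativePartTight → CornerNoDip` whose first
  hypothesis is the route item K1 and whose other two are conjecture-grade statements about the quartic pinned chain,
  taken as hypotheses (glue only: closes nothing). Landed stubs 1 (p161414) and 5 (p163224) and clause 3 of the landed
  `FibreCalculus` (p160893, K1's integrability guard) are discharged inside.

Helper file `--supports stmt-AtomisticToContinuum-16009` (lead c2, cycle 3; the seam was proved by lead c1 in cycle 2).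
-/

noncomputable section

open Filter Topology Set MeasureTheory Finset

namespace Summit.AtomisticToContinuum.FouriersLaw.Theorems.CornerNoDip.HeatProfile

open Literature.MathematicalPhysics.KineticTheory.HeatConduction

/-- **Corner estimate given the Bochner envelope and the return-value bound (K1-conditional variant of
`corner_noDip_of_profile`).** The kinematic sup bound `h2` and the sub-diffusive part of the window
hypothesis `h3` of `corner_noDip_of_profile` are traded for the Bochner envelope `|Sb ν x| ≤ Sb ν 0`
(`hEnv`; in the crux frame: clauses 4, 8, 9 of the route's `FibreCalculus` + evenness of the profile in
`x` + Fourier inversion on the circle) and the return-value bound `Sb ν 0 ≤ C√ν` eventually (`hK1`; in the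
crux frame: the conclusion of the route's K1 `LocalEnergyHalfHoelder`, whose integrability guard is clause
3 of `FibreCalculus`). Then the short range extends to `|x| ≤ δ/√ν` at cost
`(ν/2)·3·Sb ν 0·(δ/√ν)³ ≤ (3/2)·C·δ³`, so the window hypothesis is needed on the DIFFUSIVE COMPACTS
`δ < |x|√ν ≤ L` only (`h3`, for every `δ, L > 0`): modulo K1, the residual positivity input of K2 is "the
diffusively rescaled Abel heating profile has asymptotically no negative `ξ²`-mass on compacts of
`ξ ∈ (0, ∞)`" (`h3`) "and none at `ξ = ∞`" (`h4`). Pure real analysis; not a registered composition. [folklore] -/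
theorem corner_noDip_of_profile_of_envelope (Sb : ℝ → ℤ → ℝ) (S0 : ℤ → ℝ) (Ghν : ℝ → ℝ → ℝ) {a ε : ℝ}
    (ha : 0 < a) (hε : 0 < ε)
    (h1 : ∀ ν : ℝ, 0 < ν → Summable (fun x : ℤ => (1 + (x : ℝ) ^ 2) * |Sb ν x|) ∧
      (∀ k : ℝ, (2 - 2 * Real.cos k) * Ghν ν k =
        ν * ∑' x : ℤ, (1 - Real.cos (k * (x : ℝ))) * (Sb ν x - S0 x)) ∧
      Ghν ν 0 = ν / 2 * ∑' x : ℤ, (x : ℝ) ^ 2 * (Sb ν x - S0 x))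
    (h1s : Summable (fun x : ℤ => (1 + (x : ℝ) ^ 2) * |S0 x|))
    (hEnv : ∀ ν : ℝ, 0 < ν → ∀ x : ℤ, |Sb ν x| ≤ Sb ν 0)
    (hK1 : ∃ C ν₁ : ℝ, 0 < ν₁ ∧ ∀ ν : ℝ, 0 < ν → ν ≤ ν₁ → Sb ν 0 ≤ C * Real.sqrt ν)
    (h3 : ∀ δ : ℝ, 0 < δ → ∀ L : ℝ, 0 < L → ∀ ε : ℝ, 0 < ε → ∃ ν₀ : ℝ, 0 < ν₀ ∧
      ∀ ν : ℝ, 0 < ν → ν ≤ ν₀ →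
        ν * (∑' x : ℤ, (if δ < |(x : ℝ)| * Real.sqrt ν ∧ |(x : ℝ)| * Real.sqrt ν ≤ L
          then (x : ℝ) ^ 2 * max (-(Sb ν x)) 0 else 0)) ≤ ε)
    (h4 : ∀ ε : ℝ, 0 < ε → ∃ L : ℝ, 0 < L ∧ ∃ ν₀ : ℝ, 0 < ν₀ ∧ ∀ ν : ℝ, 0 < ν → ν ≤ ν₀ →
      ν * (∑' x : ℤ, (if L < |(x : ℝ)| * Real.sqrt ν then (x : ℝ) ^ 2 * max (-(Sb ν x)) 0 else 0))
        ≤ ε) :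
    ∃ ν₀ : ℝ, 0 < ν₀ ∧ ∀ ν : ℝ, 0 < ν → ν ≤ ν₀ → ∀ k : ℝ, |k| ≤ a * Real.sqrt ν →
      Ghν ν k ≤ Ghν ν 0 + ε := by
  -- constants: the envelope height Ψ(ν) = Sb ν 0 and its K1 bound
  obtain ⟨C, ν₁, hν₁, hK1⟩ := hK1
  obtain ⟨C', hCC', hC'0⟩ : ∃ C' : ℝ, C ≤ C' ∧ 0 ≤ C' := ⟨max C 0, le_max_left _ _, le_max_right _ _⟩
  have hΨ0 : ∀ ν : ℝ, 0 < ν → 0 ≤ Sb ν 0 := fun ν hν => (abs_nonneg _).trans (hEnv ν hν 0)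
  have hΨC : ∀ ν : ℝ, 0 < ν → ν ≤ ν₁ → Sb ν 0 ≤ C' * Real.sqrt ν := fun ν hν hle =>
    (hK1 ν hν hle).trans (mul_le_mul_of_nonneg_right hCC' (Real.sqrt_nonneg _))
  -- the short-range cut-off δ/√ν in diffusive units: (3/2)·C'·δ³ ≤ ε/4
  obtain ⟨δ, hδp, hδ1, hδε⟩ : ∃ δ : ℝ, 0 < δ ∧ δ ≤ 1 ∧ δ * (6 * C' + 1) ≤ ε := by
    refine ⟨min 1 (ε / (6 * C' + 1)), lt_min one_pos (by positivity), min_le_left _ _, ?_⟩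
    have h : min 1 (ε / (6 * C' + 1)) ≤ ε / (6 * C' + 1) := min_le_right _ _
    rwa [le_div_iff₀ (by positivity)] at h
  obtain ⟨L, hL, ν₄, hν₄, h4⟩ := h4 (ε / 4) (by positivity)
  obtain ⟨ν₃, hν₃, h3⟩ := h3 δ hδp L hL (ε / 4) (by positivity)
  set Cs : ℝ := ∑' x : ℤ, (1 + (x : ℝ) ^ 2) * |S0 x| with hCs
  have hCs0 : 0 ≤ Cs := tsum_nonneg fun x => by positivity
  set ν₅ : ℝ := ε / (2 * Cs + 1) with hν₅
  have hν₅p : 0 < ν₅ := by positivity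
  set ν₆ : ℝ := (Real.pi / a) ^ 2 with hν₆
  have hν₆p : 0 < ν₆ := by positivity
  have hν₇p : 0 < δ ^ 2 := by positivity
  refine ⟨min (min (min ν₁ ν₃) (min ν₄ ν₅)) (min ν₆ (δ ^ 2)), by positivity, ?_⟩
  intro ν hν hνle k hk
  have hν1' : ν ≤ ν₁ := hνle.trans ((min_le_left _ _).trans ((min_le_left _ _).trans (min_le_left _ _)))
  have hν3 : ν ≤ ν₃ := hνle.trans ((min_le_left _ _).trans ((min_le_left _ _).trans (min_le_right _ _)))
  have hν4 : ν ≤ ν₄ := hνle.trans ((min_le_left _ _).trans ((min_le_right _ _).trans (min_le_left _ _)))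
  have hν5 : ν ≤ ν₅ := hνle.trans ((min_le_left _ _).trans ((min_le_right _ _).trans (min_le_right _ _)))
  have hν6 : ν ≤ ν₆ := hνle.trans ((min_le_right _ _).trans (min_le_left _ _))
  have hν7 : ν ≤ δ ^ 2 := hνle.trans ((min_le_right _ _).trans (min_le_right _ _))
  -- the envelope height at this ν
  obtain ⟨M, hMdef⟩ : ∃ M : ℝ, M = Sb ν 0 := ⟨_, rfl⟩
  have hM0 : 0 ≤ M := by rw [hMdef]; exact hΨ0 ν hν
  have hMC : M ≤ C' * Real.sqrt ν := by rw [hMdef]; exact hΨC ν hν hν1'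
  have hsν : 0 < Real.sqrt ν := Real.sqrt_pos.mpr hν
  have hsνδ : Real.sqrt ν ≤ δ :=
    calc Real.sqrt ν ≤ Real.sqrt (δ ^ 2) := Real.sqrt_le_sqrt hν7
      _ = δ := Real.sqrt_sq hδp.le
  -- |k| ≤ π
  have hkπ : |k| ≤ Real.pi := by
    have hs : Real.sqrt ν ≤ Real.pi / a := by
      rw [← Real.sqrt_sq (by positivity : (0 : ℝ) ≤ Real.pi / a)]
      exact Real.sqrt_le_sqrt (by rw [← hν₆]; exact hν6)
    calc |k| ≤ a * Real.sqrt ν := hk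
      _ ≤ a * (Real.pi / a) := mul_le_mul_of_nonneg_left hs ha.le
      _ = Real.pi := by field_simp
  -- the case k = 0 is trivial
  rcases eq_or_ne k 0 with rfl | hk0
  · linarith
  -- cos k < 1
  have hcos : Real.cos k < 1 := by
    rcases (Real.cos_le_one k).lt_or_eq with h | h
    · exact h
    · exfalso
      obtain ⟨n, hn⟩ := (Real.cos_eq_one_iff k).mp h
      rcases eq_or_ne n 0 with rfl | hn0
      · simp at hn; exact hk0 hn.symm
      · have h1 : (1 : ℝ) ≤ |(n : ℝ)| := by
          rw [← Int.cast_abs]; exact_mod_cast Int.one_le_abs hn0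
        have h2 : |k| = |(n : ℝ)| * (2 * Real.pi) := by
          rw [← hn, abs_mul, abs_of_pos (by positivity : (0 : ℝ) < 2 * Real.pi)]
        have h3 : 2 * Real.pi ≤ |k| := by
          rw [h2]; nlinarith [Real.pi_pos]
        linarith [Real.pi_pos]
  have hd : 0 < 2 - 2 * Real.cos k := by linarith
  obtain ⟨hSum, hrep, hzero⟩ := h1 ν hν
  -- the excess profile and its summability
  have hmaj : Summable fun x : ℤ => (1 + (x : ℝ) ^ 2) * (|Sb ν x| + |S0 x|) := by
    have := hSum.add h1s
    refine this.congr fun x => ?_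
    ring
  have hdom : ∀ (c : ℝ) {g : ℤ → ℝ},
      (∀ x, |g x| ≤ c * ((1 + (x : ℝ) ^ 2) * (|Sb ν x| + |S0 x|))) → Summable g :=
    fun c g hg => Summable.of_norm_bounded (hmaj.mul_left c)
      (fun x => by simpa only [Real.norm_eq_abs] using hg x)
  have hx2le : ∀ x : ℤ, (x : ℝ) ^ 2 ≤ 1 + (x : ℝ) ^ 2 := fun x => by linarith
  have h1le : ∀ x : ℤ, (1 : ℝ) ≤ 1 + (x : ℝ) ^ 2 := fun x => by nlinarith [sq_nonneg (x : ℝ)]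
  have hEabs : ∀ x : ℤ, |Sb ν x - S0 x| ≤ |Sb ν x| + |S0 x| := fun x => abs_sub _ _
  have hSS0 : ∀ x, 0 ≤ |Sb ν x| + |S0 x| := fun x => by positivity
  -- summable pieces
  have hsE2 : Summable fun x : ℤ => (x : ℝ) ^ 2 * (Sb ν x - S0 x) := hdom 1 fun x => by
    rw [abs_mul, abs_of_nonneg (sq_nonneg _), one_mul]
    exact mul_le_mul (hx2le x) (hEabs x) (abs_nonneg _) (by positivity)
  have hc02 : ∀ x : ℤ, 0 ≤ 1 - Real.cos (k * (x : ℝ)) ∧ 1 - Real.cos (k * (x : ℝ)) ≤ 2 := fun x =>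
    ⟨by linarith [Real.cos_le_one (k * (x : ℝ))], by linarith [Real.neg_one_le_cos (k * (x : ℝ))]⟩
  have hsEc : Summable fun x : ℤ => (1 - Real.cos (k * (x : ℝ))) * (Sb ν x - S0 x) :=
    hdom 2 fun x => by
    rw [abs_mul, abs_of_nonneg (hc02 x).1]
    calc (1 - Real.cos (k * (x : ℝ))) * |Sb ν x - S0 x| ≤ 2 * (|Sb ν x| + |S0 x|) :=
          mul_le_mul (hc02 x).2 (hEabs x) (abs_nonneg _) (by norm_num)
      _ = 2 * (1 * (|Sb ν x| + |S0 x|)) := by ring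
      _ ≤ 2 * ((1 + (x : ℝ) ^ 2) * (|Sb ν x| + |S0 x|)) :=
          mul_le_mul_of_nonneg_left (mul_le_mul_of_nonneg_right (h1le x) (hSS0 x)) (by norm_num)
  -- negative part
  obtain ⟨P, hPdef⟩ : ∃ P : ℤ → ℝ, ∀ x, P x = max (-(Sb ν x)) 0 := ⟨_, fun x => rfl⟩
  have hP0 : ∀ x, 0 ≤ P x := fun x => by rw [hPdef]; exact le_max_right _ _
  have hPle : ∀ x, P x ≤ |Sb ν x| := fun x => by
    rw [hPdef]; exact max_le (neg_le_abs _) (abs_nonneg _)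
  have hPM : ∀ x, P x ≤ M := fun x => by rw [hMdef]; exact (hPle x).trans (hEnv ν hν x)
  have hnegle : ∀ x, -(Sb ν x) ≤ P x := fun x => by rw [hPdef]; exact le_max_left _ _
  -- the three ranges
  set R : ℝ := δ / Real.sqrt ν with hRdef
  have hR1 : 1 ≤ R := by rw [hRdef, le_div_iff₀ hsν, one_mul]; exact hsνδ
  set fS : ℤ → ℝ := fun x => if |(x : ℝ)| ≤ R then (x : ℝ) ^ 2 * P x else 0 with hfS
  set fM : ℤ → ℝ := fun x => if δ < |(x : ℝ)| * Real.sqrt ν ∧ |(x : ℝ)| * Real.sqrt ν ≤ L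
    then (x : ℝ) ^ 2 * P x else 0 with hfM
  set fF : ℤ → ℝ := fun x => if L < |(x : ℝ)| * Real.sqrt ν then (x : ℝ) ^ 2 * P x else 0 with hfF
  have hfS0 : ∀ x, 0 ≤ fS x := fun x => by
    simp only [hfS]; split_ifs <;> [exact mul_nonneg (sq_nonneg _) (hP0 x); exact le_rfl]
  have hfM0 : ∀ x, 0 ≤ fM x := fun x => by
    simp only [hfM]; split_ifs <;> [exact mul_nonneg (sq_nonneg _) (hP0 x); exact le_rfl]
  have hfF0 : ∀ x, 0 ≤ fF x := fun x => by
    simp only [hfF]; split_ifs <;> [exact mul_nonneg (sq_nonneg _) (hP0 x); exact le_rfl]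
  have hsplit : ∀ x : ℤ, (x : ℝ) ^ 2 * P x ≤ fS x + fM x + fF x := by
    intro x
    have hxP : 0 ≤ (x : ℝ) ^ 2 * P x := mul_nonneg (sq_nonneg _) (hP0 x)
    by_cases hA : |(x : ℝ)| ≤ R
    · have : fS x = (x : ℝ) ^ 2 * P x := by simp only [hfS, if_pos hA]
      linarith [hfM0 x, hfF0 x]
    · have hA' : δ < |(x : ℝ)| * Real.sqrt ν := by
        have h := lt_of_not_ge hA
        rwa [hRdef, div_lt_iff₀ hsν] at h
      by_cases hB : |(x : ℝ)| * Real.sqrt ν ≤ L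
      · have : fM x = (x : ℝ) ^ 2 * P x := by simp only [hfM, if_pos (And.intro hA' hB)]
        linarith [hfS0 x, hfF0 x]
      · have : fF x = (x : ℝ) ^ 2 * P x := by simp only [hfF, if_pos (lt_of_not_ge hB)]
        linarith [hfS0 x, hfM0 x]
  -- pointwise domination of the deviation summand
  have hpt : ∀ x : ℤ,
      ((1 - Real.cos (k * (x : ℝ))) / (2 - 2 * Real.cos k) - (x : ℝ) ^ 2 / 2) * (Sb ν x - S0 x) ≤
        1 / 2 * ((x : ℝ) ^ 2 * |S0 x|) + 1 / 2 * (fS x + fM x + fF x) := by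
    intro x
    obtain ⟨hK0, hK2⟩ := kernel_bounds x hcos
    set K := (x : ℝ) ^ 2 / 2 - (1 - Real.cos (k * (x : ℝ))) / (2 - 2 * Real.cos k) with hK
    have e : ((1 - Real.cos (k * (x : ℝ))) / (2 - 2 * Real.cos k) - (x : ℝ) ^ 2 / 2) *
        (Sb ν x - S0 x) = K * (S0 x - Sb ν x) := by rw [hK]; ring
    rw [e]
    have h1 : S0 x - Sb ν x ≤ |S0 x| + P x := by linarith [le_abs_self (S0 x), hnegle x]
    have h2 : 0 ≤ |S0 x| + P x := by linarith [abs_nonneg (S0 x), hP0 x]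
    calc K * (S0 x - Sb ν x) ≤ K * (|S0 x| + P x) := mul_le_mul_of_nonneg_left h1 hK0
      _ ≤ (x : ℝ) ^ 2 / 2 * (|S0 x| + P x) := mul_le_mul_of_nonneg_right hK2 h2
      _ = 1 / 2 * ((x : ℝ) ^ 2 * |S0 x|) + 1 / 2 * ((x : ℝ) ^ 2 * P x) := by ring
      _ ≤ 1 / 2 * ((x : ℝ) ^ 2 * |S0 x|) + 1 / 2 * (fS x + fM x + fF x) := by
          linarith [hsplit x]
  -- summability of everything in sight
  have hsdev : Summable fun x : ℤ =>
      ((1 - Real.cos (k * (x : ℝ))) / (2 - 2 * Real.cos k) - (x : ℝ) ^ 2 / 2) * (Sb ν x - S0 x) :=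
    hdom (1 / 2) fun x => by
      obtain ⟨hK0, hK2⟩ := kernel_bounds x hcos
      have e : |((1 - Real.cos (k * (x : ℝ))) / (2 - 2 * Real.cos k) - (x : ℝ) ^ 2 / 2) *
          (Sb ν x - S0 x)| =
          ((x : ℝ) ^ 2 / 2 - (1 - Real.cos (k * (x : ℝ))) / (2 - 2 * Real.cos k)) * |Sb ν x - S0 x| := by
        rw [abs_mul, abs_sub_comm ((1 - Real.cos (k * (x : ℝ))) / (2 - 2 * Real.cos k)),
          abs_of_nonneg hK0]
      rw [e]
      calc ((x : ℝ) ^ 2 / 2 - (1 - Real.cos (k * (x : ℝ))) / (2 - 2 * Real.cos k)) * |Sb ν x - S0 x|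
          ≤ (x : ℝ) ^ 2 / 2 * (|Sb ν x| + |S0 x|) := mul_le_mul hK2 (hEabs x) (abs_nonneg _) (by positivity)
        _ ≤ 1 / 2 * ((1 + (x : ℝ) ^ 2) * (|Sb ν x| + |S0 x|)) := by nlinarith [hSS0 x, hx2le x]
  have hsS0 : Summable fun x : ℤ => (x : ℝ) ^ 2 * |S0 x| := hdom 1 fun x => by
    rw [abs_mul, abs_of_nonneg (sq_nonneg _), abs_abs, one_mul]
    exact mul_le_mul (hx2le x) (by linarith [abs_nonneg (Sb ν x)]) (abs_nonneg _) (by positivity)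
  have hPdom : ∀ {g : ℤ → ℝ}, (∀ x, 0 ≤ g x) → (∀ x, g x ≤ (x : ℝ) ^ 2 * P x) → Summable g :=
    fun hg0 hgle => hdom 1 fun x => by
      rw [abs_of_nonneg (hg0 x), one_mul]
      calc _ ≤ (x : ℝ) ^ 2 * P x := hgle x
        _ ≤ (1 + (x : ℝ) ^ 2) * (|Sb ν x| + |S0 x|) :=
            mul_le_mul (hx2le x) ((hPle x).trans (by linarith [abs_nonneg (S0 x)])) (hP0 x)
              (by positivity)
  have hxP0 : ∀ x : ℤ, 0 ≤ (x : ℝ) ^ 2 * P x := fun x => mul_nonneg (sq_nonneg _) (hP0 x)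
  have hsfS : Summable fS := hPdom hfS0 fun x => by
    simp only [hfS]; split_ifs <;> [exact le_rfl; exact hxP0 x]
  have hsfM : Summable fM := hPdom hfM0 fun x => by
    simp only [hfM]; split_ifs <;> [exact le_rfl; exact hxP0 x]
  have hsfF : Summable fF := hPdom hfF0 fun x => by
    simp only [hfF]; split_ifs <;> [exact le_rfl; exact hxP0 x]
  -- the four bounds
  have hBstat : ∑' x : ℤ, (x : ℝ) ^ 2 * |S0 x| ≤ Cs :=
    Summable.tsum_le_tsum (fun x => mul_le_mul_of_nonneg_right (hx2le x) (abs_nonneg _)) hsS0 h1s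
  have hBshort : ∑' x : ℤ, fS x ≤ 3 * M * R ^ 3 := tsum_short_range_le hR1 hM0 P hP0 hPM
  have hBmeso : ν * ∑' x : ℤ, fM x ≤ ε / 4 := by
    have := h3 ν hν hν3
    simpa only [hfM, hPdef] using this
  have hBfar : ν * ∑' x : ℤ, fF x ≤ ε / 4 := by
    have := h4 ν hν hν4
    simpa only [hfF, hPdef] using this
  have hBshort' : ν / 2 * (3 * M * R ^ 3) ≤ ε / 4 := by
    have hR3 : ν * R ^ 3 = δ ^ 3 / Real.sqrt ν := by
      have hs3 : Real.sqrt ν ^ 3 = ν * Real.sqrt ν := by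
        rw [pow_succ, Real.sq_sqrt hν.le]
      rw [hRdef, div_pow, hs3]
      field_simp
    have hδ3 : δ ^ 3 ≤ δ := by
      have h2 : δ ^ 2 ≤ 1 := pow_le_one₀ hδp.le hδ1
      calc δ ^ 3 = δ * δ ^ 2 := by ring
        _ ≤ δ * 1 := mul_le_mul_of_nonneg_left h2 hδp.le
        _ = δ := mul_one δ
    have hq0 : 0 ≤ δ ^ 3 / Real.sqrt ν := by positivity
    calc ν / 2 * (3 * M * R ^ 3) = 3 / 2 * M * (ν * R ^ 3) := by ring
      _ = 3 / 2 * M * (δ ^ 3 / Real.sqrt ν) := by rw [hR3]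
      _ ≤ 3 / 2 * (C' * Real.sqrt ν) * (δ ^ 3 / Real.sqrt ν) :=
          mul_le_mul_of_nonneg_right (mul_le_mul_of_nonneg_left hMC (by norm_num)) hq0
      _ = 3 / 2 * C' * δ ^ 3 := by field_simp
      _ ≤ 3 / 2 * C' * δ := mul_le_mul_of_nonneg_left hδ3 (by positivity)
      _ ≤ ε / 4 := by
          have e : δ * (6 * C' + 1) = 4 * (3 / 2 * C' * δ) + δ := by ring
          rw [e] at hδε
          linarith [hδε, hδp.le]
  have hBstat' : ν / 2 * Cs ≤ ε / 4 := by
    have h : ν ≤ ε / (2 * Cs + 1) := hν5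
    rw [le_div_iff₀ (by positivity)] at h
    have h2 : ν * (2 * Cs + 1) = 4 * (ν / 2 * Cs) + ν := by ring
    rw [h2] at h
    linarith [h, hν]
  -- summing the domination
  have hsum_le : ∑' x : ℤ, ((1 - Real.cos (k * (x : ℝ))) / (2 - 2 * Real.cos k) - (x : ℝ) ^ 2 / 2) *
      (Sb ν x - S0 x) ≤ 1 / 2 * Cs + 1 / 2 * (3 * M * R ^ 3 + ∑' x : ℤ, fM x + ∑' x : ℤ, fF x) := by
    have hmaj2 : Summable fun x : ℤ => 1 / 2 * ((x : ℝ) ^ 2 * |S0 x|) + 1 / 2 * (fS x + fM x + fF x) :=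
      (hsS0.mul_left _).add (((hsfS.add hsfM).add hsfF).mul_left _)
    calc ∑' x : ℤ, ((1 - Real.cos (k * (x : ℝ))) / (2 - 2 * Real.cos k) - (x : ℝ) ^ 2 / 2) *
          (Sb ν x - S0 x)
        ≤ ∑' x : ℤ, (1 / 2 * ((x : ℝ) ^ 2 * |S0 x|) + 1 / 2 * (fS x + fM x + fF x)) :=
          Summable.tsum_le_tsum hpt hsdev hmaj2
      _ = 1 / 2 * ∑' x : ℤ, (x : ℝ) ^ 2 * |S0 x| +
            1 / 2 * (∑' x : ℤ, fS x + ∑' x : ℤ, fM x + ∑' x : ℤ, fF x) := by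
          rw [Summable.tsum_add (hsS0.mul_left _) (((hsfS.add hsfM).add hsfF).mul_left _),
            tsum_mul_left, tsum_mul_left, Summable.tsum_add (hsfS.add hsfM) hsfF,
            Summable.tsum_add hsfS hsfM]
      _ ≤ 1 / 2 * Cs + 1 / 2 * (3 * M * R ^ 3 + ∑' x : ℤ, fM x + ∑' x : ℤ, fF x) := by
          linarith [hBstat, hBshort]
  -- the representation of the difference
  have hdiff : Ghν ν k - Ghν ν 0 = ν * ∑' x : ℤ,
      ((1 - Real.cos (k * (x : ℝ))) / (2 - 2 * Real.cos k) - (x : ℝ) ^ 2 / 2) * (Sb ν x - S0 x) := by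
    have hGk : Ghν ν k = ν * (∑' x : ℤ, (1 - Real.cos (k * (x : ℝ))) * (Sb ν x - S0 x)) /
        (2 - 2 * Real.cos k) := by
      rw [eq_div_iff hd.ne', mul_comm]; exact hrep k
    have e : (fun x : ℤ => ((1 - Real.cos (k * (x : ℝ))) / (2 - 2 * Real.cos k) - (x : ℝ) ^ 2 / 2) *
        (Sb ν x - S0 x)) = fun x : ℤ => (2 - 2 * Real.cos k)⁻¹ * ((1 - Real.cos (k * (x : ℝ))) *
          (Sb ν x - S0 x)) - 1 / 2 * ((x : ℝ) ^ 2 * (Sb ν x - S0 x)) := by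
      funext x; ring
    rw [e, Summable.tsum_sub (hsEc.mul_left _) (hsE2.mul_left _), tsum_mul_left, tsum_mul_left,
      hGk, hzero]
    ring
  -- conclusion
  have hfin : Ghν ν k - Ghν ν 0 ≤ ε / 4 + ε / 4 + ε / 8 + ε / 8 := by
    rw [hdiff]
    calc ν * ∑' x : ℤ, ((1 - Real.cos (k * (x : ℝ))) / (2 - 2 * Real.cos k) - (x : ℝ) ^ 2 / 2) *
          (Sb ν x - S0 x)
        ≤ ν * (1 / 2 * Cs + 1 / 2 * (3 * M * R ^ 3 + ∑' x : ℤ, fM x + ∑' x : ℤ, fF x)) :=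
          mul_le_mul_of_nonneg_left hsum_le hν.le
      _ = ν / 2 * Cs + ν / 2 * (3 * M * R ^ 3) + 1 / 2 * (ν * ∑' x : ℤ, fM x) +
            1 / 2 * (ν * ∑' x : ℤ, fF x) := by ring
      _ ≤ ε / 4 + ε / 4 + ε / 8 + ε / 8 := by linarith [hBstat', hBshort', hBmeso, hBfar]
  linarith

/-- **GLUE (K1 + two children): `LocalEnergyHalfHoelder → DiffusiveNegativePartNegligible → FarNegativePartTight →
CornerNoDip`.** In the crux frame (energy objects `h`, `S`, `Sb` bound by their defining equations): second
hypothesis — for every `δ, L, ε > 0`, eventually in `ν`, `ν · Σ_{δ < |x|√ν ≤ L} x²·S̄_ν(x)⁻ ≤ ε` (near-positivity of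
the Abel heating profile on the diffusive compacts); third — for every `ε > 0` there are `L, ν₀ > 0` with
`ν · Σ_{L < |x|√ν} x²·S̄_ν(x)⁻ ≤ ε` for `ν ≤ ν₀` (no negative heating mass beyond the diffusive scale). The first
hypothesis is the route item K1 (stmt-AtomisticToContinuum-16008). Via `corner_noDip_of_profile_of_envelope`;
landed stubs 1, 5 and `FibreCalculus` clause 3 discharged inside. Glue only: closes nothing. [folklore] -/
theorem cornerNoDip_of_localEnergyHalfHoelder_of_diffusive_of_far :
    Summit.AtomisticToContinuum.FouriersLaw.Theses.HoelderEscapeProfile.LocalEnergyHalfHoelder →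
    (∀ ω₂ lam β γ : ℝ, 0 < ω₂ → 0 < lam → 0 < β → ∀ T : ℝ, 0 < T →
      ∀ μ : Measure ChainConfig, (pinnedChain ω₂ lam β γ).IsChainGibbsMeasure T μ → IsShiftInvariant μ →
      μ.map (fun σ : ChainConfig => fun x : ℤ => ((σ x).1, -(σ x).2)) = μ →
      ∀ D : InfiniteChainDynamics (pinnedChain ω₂ lam β γ), D.PreservesMeasure μ →
      (∀ t : ℝ, ∀ᵐ σ ∂μ, D.flow t (shift σ) = shift (D.flow t σ)) →
      ∀ h : ChainConfig → ℤ → ℝ, h = (fun (σ : ChainConfig) (x : ℤ) =>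
      (σ x).2 ^ 2 / 2 + (pinnedChain ω₂ lam β γ).U (σ x).1 +
      ((pinnedChain ω₂ lam β γ).V ((σ (x + 1)).1 - (σ x).1) +
      (pinnedChain ω₂ lam β γ).V ((σ x).1 - (σ (x - 1)).1)) / 2) →
      ∀ S : ℤ → ℝ → ℝ, S = (fun (x : ℤ) (t : ℝ) =>
      ∫ σ, (h σ 0 - ∫ σ', h σ' 0 ∂μ) * (h (D.flow t σ) x - ∫ σ', h σ' 0 ∂μ) ∂μ) →
      ∀ Sb : ℝ → ℤ → ℝ, Sb = (fun (ν : ℝ) (x : ℤ) =>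
      ν * ∫ t in Set.Ioi (0:ℝ), Real.exp (-(ν * t)) * S x t) →
      ∀ δ : ℝ, 0 < δ → ∀ L : ℝ, 0 < L → ∀ ε : ℝ, 0 < ε →
      ∃ ν₀ : ℝ, 0 < ν₀ ∧ ∀ ν : ℝ, 0 < ν → ν ≤ ν₀ →
      ν * (∑' x : ℤ, (if δ < |(x : ℝ)| * Real.sqrt ν ∧ |(x : ℝ)| * Real.sqrt ν ≤ L
      then (x : ℝ) ^ 2 * max (-(Sb ν x)) 0 else 0)) ≤ ε) →
    (∀ ω₂ lam β γ : ℝ, 0 < ω₂ → 0 < lam → 0 < β → ∀ T : ℝ, 0 < T →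
      ∀ μ : Measure ChainConfig, (pinnedChain ω₂ lam β γ).IsChainGibbsMeasure T μ → IsShiftInvariant μ →
      μ.map (fun σ : ChainConfig => fun x : ℤ => ((σ x).1, -(σ x).2)) = μ →
      ∀ D : InfiniteChainDynamics (pinnedChain ω₂ lam β γ), D.PreservesMeasure μ →
      (∀ t : ℝ, ∀ᵐ σ ∂μ, D.flow t (shift σ) = shift (D.flow t σ)) →
      ∀ h : ChainConfig → ℤ → ℝ, h = (fun (σ : ChainConfig) (x : ℤ) =>
      (σ x).2 ^ 2 / 2 + (pinnedChain ω₂ lam β γ).U (σ x).1 +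
      ((pinnedChain ω₂ lam β γ).V ((σ (x + 1)).1 - (σ x).1) +
      (pinnedChain ω₂ lam β γ).V ((σ x).1 - (σ (x - 1)).1)) / 2) →
      ∀ S : ℤ → ℝ → ℝ, S = (fun (x : ℤ) (t : ℝ) =>
      ∫ σ, (h σ 0 - ∫ σ', h σ' 0 ∂μ) * (h (D.flow t σ) x - ∫ σ', h σ' 0 ∂μ) ∂μ) →
      ∀ Sb : ℝ → ℤ → ℝ, Sb = (fun (ν : ℝ) (x : ℤ) =>
      ν * ∫ t in Set.Ioi (0:ℝ), Real.exp (-(ν * t)) * S x t) →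
      ∀ ε : ℝ, 0 < ε → ∃ L : ℝ, 0 < L ∧ ∃ ν₀ : ℝ, 0 < ν₀ ∧
      ∀ ν : ℝ, 0 < ν → ν ≤ ν₀ →
      ν * (∑' x : ℤ, (if L < |(x : ℝ)| * Real.sqrt ν
      then (x : ℝ) ^ 2 * max (-(Sb ν x)) 0 else 0)) ≤ ε) →
    Summit.AtomisticToContinuum.FouriersLaw.Theses.HoelderEscapeProfile.CornerNoDip := by
  intro hK1 h3 h4 ω₂ lam β γ hω hl hβ T hT μ hGibbs hShiftI hRev D hPres hCov G hG Gh hGh hAbs hInt a ha ε hε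
  obtain ⟨hstat, hdyn⟩ := stub_profileRepresentation ω₂ lam β γ hω hl hβ T hT μ hGibbs hShiftI hRev D hPres hCov
    _ rfl _ rfl _ rfl G hG Gh hGh hAbs hInt
  -- K1's integrability guard is clause (3) of the landed `FibreCalculus`
  obtain ⟨-, -, hIntS, -⟩ :=
    Summit.AtomisticToContinuum.FouriersLaw.Theorems.FibreCalculusSketch.fibreCalculus_proof ω₂ lam β γ
      hω hl hβ T hT μ hGibbs hShiftI hRev D hPres hCov _ rfl _ rfl _ rfl G hG Gh hGh _ rfl _ rfl
  have hK1' := hK1 ω₂ lam β γ hω hl hβ T hT μ hGibbs hShiftI hRev D hPres hCov _ rfl _ rfl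
    (fun ν hν => hIntS 0 ν hν)
  exact corner_noDip_of_profile_of_envelope _ _ Gh ha hε hdyn hstat
    (stub_bochnerEnvelope ω₂ lam β γ hω hl hβ T hT μ hGibbs hShiftI hRev D hPres hCov _ rfl _ rfl _ rfl) hK1'
    (h3 ω₂ lam β γ hω hl hβ T hT μ hGibbs hShiftI hRev D hPres hCov _ rfl _ rfl _ rfl)
    (h4 ω₂ lam β γ hω hl hβ T hT μ hGibbs hShiftI hRev D hPres hCov _ rfl _ rfl _ rfl)

end Summit.AtomisticToContinuum.FouriersLaw.Theorems.CornerNoDip.HeatProfile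

end
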